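/-
Copyright (c) 2026 the pub-hodgecm-mathlib formalisation cell (harness21).  Prover seat hodgecm-mathlib-K2E5-p16 (g3) (cross-unit hand on E3's BONUS road (d-w) of ‹J3› v2,
road owner K2E3-p03 (g3); deal (D48) «(C-ratio) COUNT», brick (C2-struct) of the road owner's DEALS 2026-09-04T03:33:10Z): `N_an = [S_an : S_an(4)] · [E¹ : E¹(4)]`.
-/
import Literature.NumberTheory.Weil1982.UnitaryFinCayleyWindow                    -- ★ R3a engine: `levelOf`, `mem_levelOf_iff`, `ballMat`, `mem_ballMat_iff`, `twoBall`, `mem_twoBall_iff`, `ballMat_mul_closed` (+ ★ D1 `mat`, `resChar`, `intMatrices`, `localIntegers`)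
import Literature.NumberTheory.Weil1982.UnitaryFinTopFormAnisotropicPlaneCount       -- ★ `placeForm_anisoPlane` (+ ★ `localNonsplitEquiv`, `localGLPiEquiv_apply_apply`, `mem_unitaryGroupOfForm_iff`)
import Literature.NumberTheory.Weil1982.UnitaryFinTopFormConjTransport               -- ★ `mem_localIntegers_iff_valued`
import Mathlib.GroupTheory.Index
import HarnessLib

/-!
# K2 ∕ E3, road (d-w) of ‹J3› v2 — (C2-struct) `K2E3WildPlaneAnisoCountStructure`: `N_an = [S_an : S_an(4)] · [E¹ : E¹(4)]` IN THE `levelOf` CURRENCY OF THE (C2) CAND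

Cell `hodgecm-mathlib` (Track B «K2-LIT»), item h413 = `stmt-HodgeConjecture-24833`, route of record `route-HodgeConjecture-HCCMUnconditional`; PROOF lane (theorems only:
no `def`, no `instance`, no `notation`, no named fact, no `sorry`), `--supports stmt-HodgeConjecture-24833 --as helper`; count-neutral.  ROAD (d-w): (W3) ⟸ (L-eq) ★ + (C-ratio) REL
★ p857088 ⟸ {(C1), (C2)}; the (C2) cand `sig_K2E3WildAnisotropicResidualCount` (K2E3-p03 (g3)) counts `N_an := (levelOf L 2 ⟨1,−ξ⟩ v 1 (ballMat L 2 v resChar) _).relIndex Z(1)`, the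
index of the level-`2·resChar` (`= 4` at a dyadic place) congruence subgroup in the COMPACT group `U_an = U(⟨1,−ξ⟩)(L⁺_v)`.  THIS FILE splits it along the determinant:
`U_an = S_an ⋊ {diag(1, ε) : ε ∈ E¹}` (`S_an` = the determinant-one part, `E¹` = the norm-one torus of `L_w ∕ L⁺_v`), and the congruence subgroup splits compatibly, so
**`N_an = [S_an : S_an ∩ K(4)] · [E¹ : E¹(4)]`** with `E¹(4) = {ε : |ε − 1|_w ≤ |2·resChar|_w}`; the torus factor is ★ (C2a) `K2E3WildPlaneTorusCount` (`2q^{2m−k}` ∕ `2q^m` at depth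
`4m`), the determinant-one factor is (C2b) (the quaternion norm-one ladder of `Λ = 𝒪_w ⊕ 𝒪_w j`, not here).

* §0 GROUP THEORY: `relIndex_sup_eq_inf_relIndex_of_normal` — `[HN : H] = [N : H ∩ N]` for `N` normal (the twin of Mathlib's `Subgroup.relIndex_sup_right` `[HN : N] = [H : H ∩ N]`;
  coset bijection `N∕(H∩N) → HN∕H`).
* §1 THE DETERMINANT AT `w`: on `G = (cmDatum L 2 ⟨1,−ξ⟩).Local v` the hom `δ = det ∘ E_w` (`E_w` = ★ `localNonsplitEquiv`, the one-place model) lands in the norm-one torus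
  (`σ_w(det g)·det g = 1` from `ᵗ(σg) J g = J`); the SECTION `ε ↦ E_w⁻¹ diag(1, ε)` (unitary for `diag(1,−ξ_w)` iff `σε·ε = 1`) shows `δ(G) = T`; `exists_subgroup_detOne`.
* §2 THE LEVEL: `g ∈ K(4)` (★ `mem_levelOf_iff`: `mat g − 1, mat g⁻¹ − 1 ∈ 2·(resChar·M₂(𝒪))`) ⇒ `|det E_w(g) − 1|_w ≤ |2·resChar|_w`; conversely `diag(1,ε)` with
  `|ε − 1|_w ≤ |2·resChar|_w` lies in `K(4)` (one place above `v`: ★ `PlacesOver.subsingleton_of_smul_eq`) ⇒ `δ(K(4)) = T_n`.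
* §3 THE INDEX: `[G : K] = [K·S : K]·[G : K·S]` (Mathlib `relIndex_mul_index`), `[G : K·S] = [δ(G) : δ(K)] = [T : T_n]` (`relIndex_map_map`), `[K·S : K] = [S : S ∩ K]` (§0,
  `S = ker δ` normal) ⇒ **`relIndex_levelOf_anisoPlane_eq_mul`** with the cand's `N_an` token on the left.

HONEST LABEL: HC_CM is proved only modulo the 7 printed citations (2 remaining named inputs: hLiu418 = stmt-HodgeConjecture-24832, h413 = stmt-HodgeConjecture-24833) until rung 0
closes; (C2)∕(C-ratio)∕(W3) are NOT proved here; count-neutral structure input for the (C2) assembler.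

## References
* [PlatonovRapinchuk1994] V. Platonov, A. Rapinchuk, *Algebraic Groups and Number Theory* (1994) — §3.3 (congruence subgroups), §5.1 (one-place models at non-split places).
* [Rogawski1990] J. D. Rogawski, *Automorphic Representations of Unitary Groups in Three Variables*, Ann. of Math. Stud. 123 (1990) — §3.8 p. 33 (`U(⟨1,−ξ⟩) = SU ⋊ U(1)`).
* [Serre1979] J.-P. Serre, *Local Fields*, GTM 67 (1979) — Ch. V §3 (the norm-one torus filtration).
* [Kottwitz1988] R. Kottwitz, *Tamagawa numbers*, Ann. of Math. 127 (1988) — §1 Thm. 1.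
-/

set_option autoImplicit false
set_option linter.dupNamespace false

noncomputable section

namespace Summit.HodgeConjecture.HodgeConjecture.Cruxes.H413.K2E3WildPlaneAnisoCountStructure

open NumberField IsDedekindDomain
open scoped Matrix MatrixGroups
open Literature.NumberTheory.Automorphic Literature.NumberTheory.Automorphic.UnitaryGroup
open Literature.NumberTheory.Weil1982.UnitaryFinTopForm

/-! ## §0 Group theory: `[HN : H] = [N : H ∩ N]` for `N` normal -/

/-- **`[HN : H] = [N : H ∩ N]`** for a normal subgroup `N` and any subgroup `H` (the coset bijection `N∕(H∩N) → HN∕H`, `n ↦ nH`; surjective because `hn·H = (hnh⁻¹)·H`).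
Twin of Mathlib's `Subgroup.relIndex_sup_right` (`[HN : N] = [H : H ∩ N]`). [folklore] -/
theorem relIndex_sup_eq_inf_relIndex_of_normal {G : Type*} [Group G] (H N : Subgroup G) [N.Normal] :
    H.relIndex (H ⊔ N) = (H ⊓ N).relIndex N := by
  classical
  rw [Subgroup.relIndex, Subgroup.relIndex, Subgroup.index, Subgroup.index]
  refine (Nat.card_congr ?_).symm
  let ι : ↥N → ↥(H ⊔ N) := fun n => ⟨n.1, Subgroup.mem_sup_right n.2⟩
  let f : ↥N ⧸ (H ⊓ N).subgroupOf N → ↥(H ⊔ N) ⧸ H.subgroupOf (H ⊔ N) :=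
    Quotient.map' ι (by
      intro a b hab
      rw [QuotientGroup.leftRel_apply] at hab ⊢
      rw [Subgroup.mem_subgroupOf] at hab ⊢
      exact (Subgroup.mem_inf.1 hab).1)
  refine Equiv.ofBijective f ⟨?_, ?_⟩
  · rintro ⟨a⟩ ⟨b⟩ hab
    have hab' : (Quotient.mk'' (ι a) : ↥(H ⊔ N) ⧸ H.subgroupOf (H ⊔ N)) = Quotient.mk'' (ι b) := hab
    apply Quotient.sound'
    rw [QuotientGroup.leftRel_apply, Subgroup.mem_subgroupOf]
    have h := QuotientGroup.eq.1 hab'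
    rw [Subgroup.mem_subgroupOf] at h
    exact Subgroup.mem_inf.2 ⟨h, N.mul_mem (N.inv_mem a.2) b.2⟩
  · rintro ⟨x⟩
    obtain ⟨h, hh, n, hn, hx⟩ := Subgroup.mem_sup_of_normal_right.1 x.2
    refine ⟨Quotient.mk'' ⟨h * n * h⁻¹, (inferInstance : N.Normal).conj_mem n hn h⟩, ?_⟩
    change (Quotient.mk'' (ι ⟨h * n * h⁻¹, _⟩) : ↥(H ⊔ N) ⧸ H.subgroupOf (H ⊔ N)) = Quotient.mk'' x
    apply QuotientGroup.eq.2
    rw [Subgroup.mem_subgroupOf]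
    change (h * n * h⁻¹)⁻¹ * x.1 ∈ H
    rw [← hx]
    simpa [mul_assoc] using hh

/-! ## §1 The determinant at `w` on `U(⟨1,−ξ⟩)(L⁺_v)` and the torus section -/

section CM

variable (L : Type) [Field L] [NumberField L] [IsCMField L] (v : HeightOneSpectrum (𝓞 ↥(maximalRealSubfield L)))
  (w : PlacesOver L v) (hw : IsCMField.complexConj L • w.1 = w.1)

/-- **Unitary matrices have norm-one determinant**: `ᵗ(σM)·J·M = J` with `det J ≠ 0` ⇒ `σ(det M) · det M = 1`. [cite: PlatonovRapinchuk1994, §2.3] -/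
theorem map_det_mul_det_eq_one_of_unitary {K : Type*} [Field K] (σ : K →+* K) {n : Type*} [Fintype n] [DecidableEq n] {J M : Matrix n n K}
    (hJ : J.det ≠ 0) (hM : (M.map σ)ᵀ * J * M = J) : σ M.det * M.det = 1 := by
  have h := congrArg Matrix.det hM
  rw [Matrix.det_mul, Matrix.det_mul, Matrix.det_transpose, ← RingHom.mapMatrix_apply, ← RingHom.map_det] at h
  have h' : (σ M.det * M.det) * J.det = 1 * J.det := by rw [one_mul]; linear_combination h
  exact mul_right_cancel₀ hJ h'

/-- The diagonal matrix `diag(1, ε)` is unitary for `diag(1, −ξ)` iff `σε·ε = 1`; here the «if» direction. [cite: Rogawski1990, §3.8 p. 33] -/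
theorem diag_mem_unitaryGroupOfForm {K : Type*} [Field K] (σ : K →+* K) (ξ : K) {ε : K} (hε : σ ε * ε = 1) (hε0 : (!![(1 : K), 0; 0, ε]).det ≠ 0) :
    Matrix.GeneralLinearGroup.mkOfDetNeZero !![(1 : K), 0; 0, ε] hε0 ∈ unitaryGroupOfForm σ !![(1 : K), 0; 0, -ξ] := by
  rw [mem_unitaryGroupOfForm_iff]
  change ((!![(1 : K), 0; 0, ε] : Matrix (Fin 2) (Fin 2) K).map σ)ᵀ * !![(1 : K), 0; 0, -ξ] * !![(1 : K), 0; 0, ε] = !![(1 : K), 0; 0, -ξ]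
  ext i j
  fin_cases i <;> fin_cases j
  · simp [Matrix.mul_apply, Fin.sum_univ_two]
  · simp [Matrix.mul_apply, Fin.sum_univ_two]
  · simp [Matrix.mul_apply, Fin.sum_univ_two]
  · simp [Matrix.mul_apply, Fin.sum_univ_two]
    linear_combination ξ * hε

/-- Valuation of `det(1 + c·X) − 1` for a `2 × 2` matrix with integral `X` and `|c| ≤ 1`: `≤ |c|`. [cite: PlatonovRapinchuk1994, §3.3] -/
theorem valued_det_sub_one_le {K : Type*} [Field K] [Valued K (WithZero (Multiplicative ℤ))] (c : K) (hc : Valued.v c ≤ 1) (M X : Matrix (Fin 2) (Fin 2) K)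
    (hM : ∀ i j, M i j = (1 : Matrix (Fin 2) (Fin 2) K) i j + c * X i j) (hX : ∀ i j, Valued.v (X i j) ≤ 1) :
    Valued.v (M.det - 1) ≤ Valued.v c := by
  have hdet : M.det - 1 = c * (X 0 0 + X 1 1 + c * (X 0 0 * X 1 1 - X 0 1 * X 1 0)) := by
    rw [Matrix.det_fin_two, hM 0 0, hM 0 1, hM 1 0, hM 1 1]
    simp only [Matrix.one_apply_eq, Matrix.one_apply_ne (show (0 : Fin 2) ≠ 1 by decide), Matrix.one_apply_ne (show (1 : Fin 2) ≠ 0 by decide)]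
    ring
  rw [hdet, map_mul]
  refine mul_le_of_le_one_right zero_le ?_
  refine (Valuation.map_add _ _ _).trans (max_le ((Valuation.map_add _ _ _).trans (max_le (hX 0 0) (hX 1 1))) ?_)
  rw [map_mul]
  refine mul_le_one' hc ((Valuation.map_sub _ _ _).trans (max_le ?_ ?_))
  · rw [map_mul]; exact mul_le_one' (hX 0 0) (hX 1 1)
  · rw [map_mul]; exact mul_le_one' (hX 0 1) (hX 1 0)

set_option maxHeartbeats 400000 in
include hw in
/-- **(C2-struct): `N_an = [S_an : S_an ∩ K(4)] · [E¹ : E¹(4)]`.**  On `G = U(⟨1,−ξ⟩)(L⁺_v) = (cmDatum L 2 !![1,0;0,−ξ]).Local v` (`w ∣ v` non-split, `ξ_w ≠ 0` via `|ξ|_w = 1`),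
with `S` = the determinant-one subgroup (read in the one-place model ★ `localNonsplitEquiv`), `T` = the norm-one torus of `L_w ∕ L⁺_v` and `T_n` its level
`|t − 1|_w ≤ |2·resChar|_w` (hypothesis-characterised, ★ LH4-p02 currency), the (C2) cand's count splits:
`(levelOf L 2 ⟨1,−ξ⟩ v 1 (ballMat L 2 v resChar) _).relIndex Z(1) = (levelOf … ⊓ S).relIndex S · T_n.relIndex T`.
[cite: PlatonovRapinchuk1994, §3.3, §5.1] [cite: Rogawski1990, §3.8 p. 33] -/
theorem relIndex_levelOf_anisoPlane_eq_mul {ξ : L} (hξ1 : Valued.v (algebraMap L (w.1.adicCompletion L) ξ) = 1)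
    (ha : ∀ w' : PlacesOver L v, Valued.v (((resChar L v : ℕ) : LocalRing L v) w') < 1)
    (S : Subgroup ((cmDatum L 2 !![(1 : L), 0; 0, -ξ]).Local v))
    (hS : ∀ g : (cmDatum L 2 !![(1 : L), 0; 0, -ξ]).Local v, g ∈ S ↔
      (((localNonsplitEquiv (IsCMField.complexConj L) !![(1 : L), 0; 0, -ξ] (IsCMField.complexConj_ne_one L) w hw g :
          ↥(unitaryGroupOfForm (galAdicCompletionMap (L := L) (IsCMField.complexConj L) hw) (placeForm !![(1 : L), 0; 0, -ξ] w.1))) :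
        GL (Fin 2) (w.1.adicCompletion L)) : Matrix (Fin 2) (Fin 2) (w.1.adicCompletion L)).det = 1)
    (T Tn : Subgroup (w.1.adicCompletion L)ˣ)
    (hT : ∀ t : (w.1.adicCompletion L)ˣ, t ∈ T ↔ galAdicCompletionMap (L := L) (IsCMField.complexConj L) hw (t : w.1.adicCompletion L) * t = 1)
    (hTn : ∀ t : (w.1.adicCompletion L)ˣ, t ∈ Tn ↔ galAdicCompletionMap (L := L) (IsCMField.complexConj L) hw (t : w.1.adicCompletion L) * t = 1 ∧
      Valued.v ((t : w.1.adicCompletion L) - 1) ≤ Valued.v (((2 : LocalRing L v) * ((resChar L v : ℕ) : LocalRing L v)) w)) :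
    (levelOf L 2 !![(1 : L), 0; 0, -ξ] v 1 (ballMat L 2 v ((resChar L v : ℕ) : LocalRing L v))
          (ballMat_mul_closed L 2 v (mem_localIntegers_of_forall_valued_lt_one L v ha))).relIndex
        (Subgroup.centralizer ({(1 : (cmDatum L 2 !![(1 : L), 0; 0, -ξ]).Local v)} : Set _)) =
      (levelOf L 2 !![(1 : L), 0; 0, -ξ] v 1 (ballMat L 2 v ((resChar L v : ℕ) : LocalRing L v))
          (ballMat_mul_closed L 2 v (mem_localIntegers_of_forall_valued_lt_one L v ha)) ⊓ S).relIndex S * Tn.relIndex T := by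
  classical
  haveI : Algebra.IsQuadraticExtension ↥(maximalRealSubfield L) L := IsCMField.isQuadraticExtension L
  have hc1 : IsCMField.complexConj L ≠ 1 := IsCMField.complexConj_ne_one L
  haveI : Subsingleton (PlacesOver L v) := PlacesOver.subsingleton_of_smul_eq (IsCMField.complexConj L) hc1 w hw
  -- names
  set σw := galAdicCompletionMap (L := L) (IsCMField.complexConj L) hw with hσw
  set e := localNonsplitEquiv (IsCMField.complexConj L) !![(1 : L), 0; 0, -ξ] hc1 w hw with he_def
  set a : LocalRing L v := ((resChar L v : ℕ) : LocalRing L v) with ha_def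
  set K := levelOf L 2 !![(1 : L), 0; 0, -ξ] v 1 (ballMat L 2 v a) (ballMat_mul_closed L 2 v (mem_localIntegers_of_forall_valued_lt_one L v ha)) with hK
  have hJ : placeForm !![(1 : L), 0; 0, -ξ] w.1 = !![(1 : w.1.adicCompletion L), 0; 0, -algebraMap L (w.1.adicCompletion L) ξ] := placeForm_anisoPlane L v w ξ
  have hξ0 : algebraMap L (w.1.adicCompletion L) ξ ≠ 0 := fun h0 => by rw [h0, map_zero] at hξ1; exact zero_ne_one hξ1
  have hJdet : (!![(1 : w.1.adicCompletion L), 0; 0, -algebraMap L (w.1.adicCompletion L) ξ]).det ≠ 0 := by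
    rw [Matrix.det_fin_two_of]; simp [hξ0]
  -- the level element `2a` at `w`: non-zero, small
  have ha2 : ((2 : LocalRing L v) * a) w = 2 * a w := rfl
  have hcle : Valued.v (((2 : LocalRing L v) * a) w) ≤ 1 := by
    rw [ha2, map_mul]
    refine mul_le_one' ?_ (ha w).le
    rw [show (2 : w.1.adicCompletion L) = 1 + 1 by norm_num]
    exact (Valuation.map_add _ _ _).trans (by rw [Valuation.map_one, max_self])
  have hc0 : ((2 : LocalRing L v) * a) w ≠ 0 := by
    rw [ha2, ha_def]
    change (2 : w.1.adicCompletion L) * ((resChar L v : ℕ) : w.1.adicCompletion L) ≠ 0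
    exact mul_ne_zero two_ne_zero (Nat.cast_ne_zero.2 (resChar_ne_zero L v))
  -- the determinant hom at `w`
  let δ : (cmDatum L 2 !![(1 : L), 0; 0, -ξ]).Local v →* (w.1.adicCompletion L)ˣ :=
    Matrix.GeneralLinearGroup.det.comp ((unitaryGroupOfForm σw (placeForm !![(1 : L), 0; 0, -ξ] w.1)).subtype.comp e.toMonoidHom)
  have hδ : ∀ g, ((δ g : (w.1.adicCompletion L)ˣ) : w.1.adicCompletion L) =
      (((e g : ↥(unitaryGroupOfForm σw (placeForm !![(1 : L), 0; 0, -ξ] w.1))) : GL (Fin 2) (w.1.adicCompletion L)) : Matrix (Fin 2) (Fin 2) (w.1.adicCompletion L)).det :=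
    fun g => rfl
  have hSker : S = δ.ker := by
    ext g
    rw [hS, MonoidHom.mem_ker, ← Units.val_eq_one, hδ]
  haveI hSn : S.Normal := by rw [hSker]; infer_instance
  -- norm one of determinants
  have hJdet' : (placeForm !![(1 : L), 0; 0, -ξ] w.1).det ≠ 0 := by rw [hJ]; exact hJdet
  have hnorm : ∀ g, σw (δ g : w.1.adicCompletion L) * (δ g : w.1.adicCompletion L) = 1 := by
    intro g
    rw [hδ]
    exact map_det_mul_det_eq_one_of_unitary σw hJdet' (mem_unitaryGroupOfForm_iff.1 (e g).2)
  -- the section `ε ↦ E_w⁻¹ diag(1, ε)`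
  have hdetD : ∀ ε : (w.1.adicCompletion L)ˣ, (!![(1 : w.1.adicCompletion L), 0; 0, (ε : w.1.adicCompletion L)]).det ≠ 0 := fun ε => by
    rw [Matrix.det_fin_two_of]; simp [ε.ne_zero]
  have hsecU : ∀ ε : (w.1.adicCompletion L)ˣ, σw ε * ε = 1 →
      Matrix.GeneralLinearGroup.mkOfDetNeZero _ (hdetD ε) ∈ unitaryGroupOfForm σw (placeForm !![(1 : L), 0; 0, -ξ] w.1) := fun ε hε => by
    rw [hJ]; exact diag_mem_unitaryGroupOfForm σw _ hε (hdetD ε)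
  let sec : ∀ ε : (w.1.adicCompletion L)ˣ, σw ε * ε = 1 → (cmDatum L 2 !![(1 : L), 0; 0, -ξ]).Local v :=
    fun ε hε => e.symm ⟨Matrix.GeneralLinearGroup.mkOfDetNeZero _ (hdetD ε), hsecU ε hε⟩
  have he_sec : ∀ ε hε, e (sec ε hε) = ⟨Matrix.GeneralLinearGroup.mkOfDetNeZero _ (hdetD ε), hsecU ε hε⟩ := fun ε hε => e.apply_symm_apply _
  have hδ_sec : ∀ ε hε, δ (sec ε hε) = ε := by
    intro ε hε
    apply Units.ext
    rw [hδ, he_sec ε hε]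
    change (!![(1 : w.1.adicCompletion L), 0; 0, (ε : w.1.adicCompletion L)]).det = ε
    rw [Matrix.det_fin_two_of]; simp
  -- the `w`-entries of `mat (sec ε)` are those of `diag(1, ε)`
  have hmat_sec : ∀ ε hε (i j : Fin 2), (mat L 2 !![(1 : L), 0; 0, -ξ] v (sec ε hε)) i j w = (!![(1 : w.1.adicCompletion L), 0; 0, (ε : w.1.adicCompletion L)]) i j := by
    intro ε hε i j
    have h : ((((e (sec ε hε) : ↥(unitaryGroupOfForm σw (placeForm !![(1 : L), 0; 0, -ξ] w.1))) : GL (Fin 2) (w.1.adicCompletion L)) :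
        Matrix (Fin 2) (Fin 2) (w.1.adicCompletion L)) i j) = (mat L 2 !![(1 : L), 0; 0, -ξ] v (sec ε hε)) i j w :=
      localGLPiEquiv_apply_apply L 2 v (((sec ε hε).val : GL (Fin 2) (LocalRing L v))) w i j
    rw [he_sec ε hε] at h
    exact h.symm
  -- §2 LEVEL, easy direction: `g ∈ K ⇒ δ g ∈ Tn`
  have hKsub : ∀ g ∈ K, δ g ∈ Tn := by
    intro g hg
    rw [hTn]
    refine ⟨hnorm g, ?_⟩
    obtain ⟨-, h1, -⟩ := (mem_levelOf_iff L 2 !![(1 : L), 0; 0, -ξ] v 1 _ _ g).1 hg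
    obtain ⟨Y, hY, hY2⟩ := (mem_twoBall_iff L 2 v _ _).1 h1
    obtain ⟨X, hX, rfl⟩ := (mem_ballMat_iff L 2 v a Y).1 hY
    -- `mat g = 1 + (2a)•X`; read at `w`
    have hMat : ∀ i j, ((((e g : ↥(unitaryGroupOfForm σw (placeForm !![(1 : L), 0; 0, -ξ] w.1))) : GL (Fin 2) (w.1.adicCompletion L)) :
        Matrix (Fin 2) (Fin 2) (w.1.adicCompletion L)) i j) = (1 : Matrix (Fin 2) (Fin 2) (w.1.adicCompletion L)) i j + ((2 : LocalRing L v) * a) w * X i j w := by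
      intro i j
      have h : ((((e g : ↥(unitaryGroupOfForm σw (placeForm !![(1 : L), 0; 0, -ξ] w.1))) : GL (Fin 2) (w.1.adicCompletion L)) :
          Matrix (Fin 2) (Fin 2) (w.1.adicCompletion L)) i j) = (mat L 2 !![(1 : L), 0; 0, -ξ] v g) i j w :=
        localGLPiEquiv_apply_apply L 2 v ((g.val : GL (Fin 2) (LocalRing L v))) w i j
      rw [h]
      have hmg : mat L 2 !![(1 : L), 0; 0, -ξ] v g = 1 + (2 : LocalRing L v) • (a • X) := by rw [hY2]; abel
      have hij := congrFun (congrFun hmg i) j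
      change (mat L 2 !![(1 : L), 0; 0, -ξ] v g) i j w = _
      rw [hij, Matrix.add_apply, Matrix.smul_apply, Matrix.smul_apply, Pi.add_apply, smul_eq_mul, smul_eq_mul, Pi.mul_apply, Pi.mul_apply, ha2]
      have h2w : (2 : LocalRing L v) w = (2 : w.1.adicCompletion L) := rfl
      congr 1
      · fin_cases i <;> fin_cases j <;> rfl
      · rw [h2w]; ring
    have hXw : ∀ i j, Valued.v (X i j w) ≤ 1 := fun i j =>
      (mem_localIntegers_iff_valued L v (X i j)).1 ((Literature.NumberTheory.Weil1982.UnitaryFinTopForm.mem_intMatrices_iff L 2 v X).1 hX i j) w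
    rw [hδ]
    exact valued_det_sub_one_le _ hcle _ (fun i j => X i j w) hMat hXw
  -- §2 LEVEL, section direction: `ε ∈ Tn ⇒ sec ε ∈ K`
  -- (a) a matrix of `G` whose `w`-component is `diag(1, η)` with `|η − 1| ≤ |2a|` is `≡ 1 (mod 2a·M₂(𝒪))`
  have hdiag_sub_one_mem : ∀ (g : (cmDatum L 2 !![(1 : L), 0; 0, -ξ]).Local v) (η : w.1.adicCompletion L),
      (∀ i j : Fin 2, (mat L 2 !![(1 : L), 0; 0, -ξ] v g) i j w = (!![(1 : w.1.adicCompletion L), 0; 0, η]) i j) →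
      Valued.v (η - 1) ≤ Valued.v (((2 : LocalRing L v) * a) w) →
      mat L 2 !![(1 : L), 0; 0, -ξ] v g - 1 ∈ twoBall L 2 v (ballMat L 2 v a) := by
    intro g η hg hηn
    have hm1 : ∀ i j : Fin 2, (mat L 2 !![(1 : L), 0; 0, -ξ] v g - 1) i j w =
        (!![(1 : w.1.adicCompletion L), 0; 0, η] - 1 : Matrix (Fin 2) (Fin 2) (w.1.adicCompletion L)) i j := by
      intro i j
      rw [Matrix.sub_apply, Matrix.sub_apply, Pi.sub_apply, hg i j]
      congr 1
      fin_cases i <;> fin_cases j <;> rfl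
    have hval : ∀ i j : Fin 2, Valued.v ((!![(1 : w.1.adicCompletion L), 0; 0, η] - 1 : Matrix (Fin 2) (Fin 2) (w.1.adicCompletion L)) i j) ≤
        Valued.v (((2 : LocalRing L v) * a) w) := by
      intro i j
      fin_cases i <;> fin_cases j
      · simp
      · simp
      · simp
      · simpa using hηn
    have hc0' : ∀ w' : PlacesOver L v, ((2 : LocalRing L v) * a) w' ≠ 0 := fun w' => by
      obtain rfl : w' = w := Subsingleton.elim w' w
      exact hc0
    rw [mem_twoBall_iff]
    refine ⟨a • fun i j w' => (mat L 2 !![(1 : L), 0; 0, -ξ] v g - 1) i j w' / (((2 : LocalRing L v) * a) w'), (mem_ballMat_iff L 2 v a _).2 ⟨_, ?_, rfl⟩, ?_⟩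
    · rw [Literature.NumberTheory.Weil1982.UnitaryFinTopForm.mem_intMatrices_iff]
      intro i j
      rw [mem_localIntegers_iff_valued]
      intro w'
      obtain rfl : w' = w := Subsingleton.elim w' w
      rw [map_div₀, hm1]
      exact div_le_one_of_le₀ (hval i j) zero_le
    · refine Matrix.ext fun i j => funext fun w' => ?_
      have h0 : (2 : w'.1.adicCompletion L) * a w' ≠ 0 := hc0' w'
      have h20 : (2 : w'.1.adicCompletion L) ≠ 0 := left_ne_zero_of_mul h0
      have ha0 : a w' ≠ 0 := right_ne_zero_of_mul h0
      change (2 : w'.1.adicCompletion L) * (a w' * ((mat L 2 !![(1 : L), 0; 0, -ξ] v g - 1) i j w' / ((2 : w'.1.adicCompletion L) * a w'))) =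
        (mat L 2 !![(1 : L), 0; 0, -ξ] v g - 1) i j w'
      field_simp
  -- (b) the `w`-component of `mat (sec ε)⁻¹` is `diag(1, ε⁻¹)` (solve `mat g⁻¹ · mat g = 1` at `w`)
  have hmat_sec_inv : ∀ (ε : (w.1.adicCompletion L)ˣ) (hε : σw ε * ε = 1) (i j : Fin 2),
      (mat L 2 !![(1 : L), 0; 0, -ξ] v (sec ε hε)⁻¹) i j w = (!![(1 : w.1.adicCompletion L), 0; 0, ((ε⁻¹ : (w.1.adicCompletion L)ˣ) : w.1.adicCompletion L)]) i j := by
    intro ε hε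
    have hPQ := mat_inv_mul L 2 !![(1 : L), 0; 0, -ξ] v (sec ε hε)
    have hent : ∀ i j : Fin 2, (mat L 2 !![(1 : L), 0; 0, -ξ] v (sec ε hε)⁻¹) i 0 w * (!![(1 : w.1.adicCompletion L), 0; 0, (ε : w.1.adicCompletion L)]) 0 j +
        (mat L 2 !![(1 : L), 0; 0, -ξ] v (sec ε hε)⁻¹) i 1 w * (!![(1 : w.1.adicCompletion L), 0; 0, (ε : w.1.adicCompletion L)]) 1 j =
        (1 : Matrix (Fin 2) (Fin 2) (w.1.adicCompletion L)) i j := by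
      intro i j
      have h := congrFun (congrFun (congrFun hPQ i) j) w
      rw [Matrix.mul_apply, Fin.sum_univ_two, Pi.add_apply, Pi.mul_apply, Pi.mul_apply, hmat_sec ε hε 0 j, hmat_sec ε hε 1 j] at h
      rw [h]
      fin_cases i <;> fin_cases j <;> rfl
    have hε0 : (ε : w.1.adicCompletion L) ≠ 0 := ε.ne_zero
    intro i j
    fin_cases i <;> fin_cases j
    · simpa using hent 0 0
    · have h := hent 0 1
      simp only [Matrix.of_apply, Matrix.cons_val', Matrix.cons_val_zero, Matrix.cons_val_one, Matrix.empty_val', Matrix.cons_val_fin_one, Fin.isValue,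
        mul_zero, zero_add, Matrix.one_apply_ne (show (0 : Fin 2) ≠ 1 by decide)] at h
      simpa [hε0] using h
    · simpa using hent 1 0
    · have h := hent 1 1
      simp only [Matrix.of_apply, Matrix.cons_val', Matrix.cons_val_zero, Matrix.cons_val_one, Matrix.empty_val', Matrix.cons_val_fin_one, Fin.isValue,
        mul_zero, zero_add, Matrix.one_apply_eq] at h
      simp only [Matrix.of_apply, Matrix.cons_val', Matrix.empty_val', Matrix.cons_val_fin_one,
        Units.val_inv_eq_inv_val]
      exact eq_inv_of_mul_eq_one_left h
  -- (c) `sec t ∈ K` for `t ∈ Tn`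
  have hsecK : ∀ t ∈ Tn, ∃ ht1 : σw t * t = 1, sec t ht1 ∈ K := by
    intro t ht
    obtain ⟨ht1, htn⟩ := (hTn t).1 ht
    obtain ⟨-, htn'⟩ := (hTn t⁻¹).1 (Tn.inv_mem ht)
    refine ⟨ht1, (mem_levelOf_iff L 2 !![(1 : L), 0; 0, -ξ] v 1 _ _ _).2 ⟨?_, ?_, ?_⟩⟩
    · exact Subgroup.mem_centralizer_iff.2 fun h hh => by rw [Set.mem_singleton_iff.1 hh, one_mul, mul_one]
    · exact hdiag_sub_one_mem (sec t ht1) t (hmat_sec t ht1) htn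
    · exact hdiag_sub_one_mem (sec t ht1)⁻¹ ((t⁻¹ : (w.1.adicCompletion L)ˣ) : w.1.adicCompletion L) (hmat_sec_inv t ht1) htn'
  -- `δ(G) = T`, `δ(K) = Tn`
  have hmapT : Subgroup.map δ ⊤ = T := by
    ext t
    constructor
    · rintro ⟨g, -, rfl⟩
      exact (hT _).2 (hnorm g)
    · intro ht
      exact ⟨sec t ((hT t).1 ht), Subgroup.mem_top _, hδ_sec t ((hT t).1 ht)⟩
  have hmapK : Subgroup.map δ K = Tn := by
    ext t
    constructor
    · rintro ⟨g, hg, rfl⟩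
      exact hKsub g hg
    · intro ht
      obtain ⟨ht1, hmem⟩ := hsecK t ht
      exact ⟨sec t ht1, hmem, hδ_sec t ht1⟩
  -- §3 the index
  have hZ : Subgroup.centralizer ({(1 : (cmDatum L 2 !![(1 : L), 0; 0, -ξ]).Local v)} : Set _) = ⊤ :=
    eq_top_iff.2 fun g _ => Subgroup.mem_centralizer_iff.2 fun h hh => by rw [Set.mem_singleton_iff.1 hh, one_mul, mul_one]
  rw [hZ, Subgroup.relIndex_top_right]
  have h1 : K.index = K.relIndex (K ⊔ S) * (K ⊔ S).index := (Subgroup.relIndex_mul_index le_sup_left).symm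
  have h2 : K.relIndex (K ⊔ S) = (K ⊓ S).relIndex S := relIndex_sup_eq_inf_relIndex_of_normal K S
  have h3 : (K ⊔ S).index = Tn.relIndex T := by
    have h := Subgroup.relIndex_map_map δ K ⊤
    rw [hmapK, hmapT, ← hSker, top_sup_eq, Subgroup.relIndex_top_right] at h
    exact h.symm
  rw [h1, h2, h3]

include hw in
/-- The determinant-one subgroup `S ≤ U(⟨1,−ξ⟩)(L⁺_v)` of (C2-struct) exists: `S = ker (det ∘ E_w)` read through the one-place model
★ `localNonsplitEquiv` (so the hypothesis `hS` of `relIndex_levelOf_anisoPlane_eq_mul` is instantiable). -/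
theorem exists_subgroup_detOne (ξ : L) :
    ∃ S : Subgroup ((cmDatum L 2 !![(1 : L), 0; 0, -ξ]).Local v), ∀ g : (cmDatum L 2 !![(1 : L), 0; 0, -ξ]).Local v, g ∈ S ↔
      (((localNonsplitEquiv (IsCMField.complexConj L) !![(1 : L), 0; 0, -ξ] (IsCMField.complexConj_ne_one L) w hw g :
          ↥(unitaryGroupOfForm (galAdicCompletionMap (L := L) (IsCMField.complexConj L) hw) (placeForm !![(1 : L), 0; 0, -ξ] w.1))) :
        GL (Fin 2) (w.1.adicCompletion L)) : Matrix (Fin 2) (Fin 2) (w.1.adicCompletion L)).det = 1 := by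
  let δ : (cmDatum L 2 !![(1 : L), 0; 0, -ξ]).Local v →* (w.1.adicCompletion L)ˣ :=
    Matrix.GeneralLinearGroup.det.comp ((unitaryGroupOfForm (galAdicCompletionMap (L := L) (IsCMField.complexConj L) hw)
      (placeForm !![(1 : L), 0; 0, -ξ] w.1)).subtype.comp
      (localNonsplitEquiv (IsCMField.complexConj L) !![(1 : L), 0; 0, -ξ] (IsCMField.complexConj_ne_one L) w hw).toMonoidHom)
  refine ⟨δ.ker, fun g => ?_⟩
  rw [MonoidHom.mem_ker, ← Units.val_eq_one]
  rfl

end CM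

end Summit.HodgeConjecture.HodgeConjecture.Cruxes.H413.K2E3WildPlaneAnisoCountStructure

end
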